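import Literature.NumberTheory.NumberFields.CyclotomicTwoPowerPrimesOverBound
import Mathlib.NumberTheory.Multiplicity
import HarnessLib

/-!
# Bounded decomposition in the `p`-power cyclotomic tower (`p` odd): a rational prime `ℓ` has at most
# `(ℓ^{p−1} − 1)·(p − 1)` primes above it in `ℚ(ζ_{p^{k+1}})`, uniformly in `k` — and hence in every subfield

Topic `NumberTheory/NumberFields` (namespace = path).  THEOREM-ONLY file (no definition, no named fact, no instance, no `sorry`),
written by the prover seat `bsd-potss-rkm` g42 (cell `bsd-potss`, item stmt-BirchSwinnertonDyer-19196; library pass): the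
odd-`p` twin of bsd-2adic's `CyclotomicTwoPowerPrimesOverBound.lean` — «every prime is finitely decomposed in the cyclotomic
`ℤ_p`-extension `ℚ_∞`» in the uniform finite-level form needed by Iwasawa's 1973 ascent
(`IwasawaTheory/ClassicalMuVanishesCyclicAscentOdd.lean`: at most `T` ramified primes in every layer).

* §1 `pow_dvd_mul_of_dvd_pow_sub_one_odd` — for `p` odd, `p ∤ ℓ`: `p^m ∣ ℓ^{(p−1)p^a} − 1 ⟹ p^m ∣ (ℓ^{p−1} − 1)·p^a`
  (lifting the exponent, Mathlib `padicValNat.pow_sub_pow`: `v_p(x^{p^a} − 1) = v_p(x − 1) + a` for `x = ℓ^{p−1} ≡ 1 (p)`).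
* §2 `ncard_primesOver_le_of_isCyclotomicExtension_prime_pow_odd` — for `N = ℚ(ζ_{p^{k+1}})`, `p` odd, `ℓ ≠ p`:
  `#{𝔔 ∣ ℓ} ≤ (ℓ^{p−1} − 1)(p − 1)`.  Mathlib: `ℓ` is unramified in `N` with residue degree `f = ord(ℓ mod p^{k+1})`, `g·f = (p−1)p^k`;
  writing `f = d·p^a` with `p ∤ d` one has `d ∣ p − 1`, `p^{k+1} ∣ ℓ^f − 1 ∣ ℓ^{(p−1)p^a} − 1`, so `p^{k+1} ∣ (ℓ^{p−1}−1)·p^a` (§1) and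
  `g·p ≤ g·d·p = (p−1)p^{k+1}/p^a ≤ (p−1)(ℓ^{p−1} − 1)`.  `ncard_primesOver_eq_one_of_isCyclotomicExtension_prime_pow_odd` — `ℓ = p`:
  exactly one prime (Mathlib `ncard_primesOver_of_prime_pow`).
* §3 `ncard_primesOver_le_of_algebra_isCyclotomicExtension_prime_pow_odd` — the uniform bound `(ℓ^{p−1} − 1)(p − 1)` for EVERY prime `ℓ`
  in EVERY subfield of `ℚ(ζ_{p^{k+1}})` (going down, tree `ncard_primesOver_le_of_algebra`).

HONEST SCOPE: elementary; the sharp count is not needed and not proved.  Nothing here is specific to any summit; BSD is not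
proved by any of this.

## References
* L. C. Washington, *Introduction to Cyclotomic Fields* (1997), Thm. 2.13 (splitting in `ℚ(ζ_m)`: `f = ord(ℓ mod m)`), §13.1
  (finitely many primes of `ℚ_∞` above each prime). [Washington1997]
* J. Neukirch, *Algebraic Number Theory* (1999), Ch. I §8 (fundamental identity). [NeukirchANT1999]
-/

set_option autoImplicit false

noncomputable section

open NumberField IsDedekindDomain Ideal

namespace Literature.NumberTheory.NumberFields

/-! ## §1 Lifting the exponent for `ℓ^{(p−1)p^a} − 1` -/

/-- **`p^m ∣ ℓ^{(p−1)p^a} − 1 ⟹ p^m ∣ (ℓ^{p−1} − 1)·p^a`** for an odd prime `p` not dividing `ℓ ≥ 2` (LTE: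
`v_p(x^{p^a} − 1) = v_p(x − 1) + a` for `x = ℓ^{p−1}`, `p ∣ x − 1` by Fermat, `p ∤ x`).
[cite: Washington1997, §13.1 (the primes of `ℚ_∞` above `ℓ`)] -/
theorem pow_dvd_mul_of_dvd_pow_sub_one_odd {p ℓ : ℕ} (hp : p.Prime) (hodd : p ≠ 2) (hℓ : 2 ≤ ℓ) (hpl : ¬ p ∣ ℓ)
    (a m : ℕ) (h : p ^ m ∣ ℓ ^ ((p - 1) * p ^ a) - 1) : p ^ m ∣ (ℓ ^ (p - 1) - 1) * p ^ a := by
  haveI : Fact p.Prime := ⟨hp⟩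
  set x := ℓ ^ (p - 1) with hx
  have hp1 : 1 ≤ p - 1 := by have := hp.two_le; omega
  have hx1 : 1 < x := by
    rw [hx]; exact Nat.one_lt_pow (by omega) (by omega)
  -- Fermat: `p ∣ x − 1`
  have hfermat : p ∣ x - 1 := by
    have hcop : Nat.Coprime ℓ p := (Nat.coprime_comm.mp ((Nat.Prime.coprime_iff_not_dvd hp).mpr hpl))
    have hmod : x ≡ 1 [MOD p] := by
      rw [hx, ← Nat.totient_prime hp]
      exact Nat.ModEq.pow_totient hcop
    exact (Nat.modEq_iff_dvd' hx1.le).mp hmod.symm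
  have hpx : ¬ p ∣ x := fun hdvd ↦ hpl (hp.dvd_of_dvd_pow hdvd)
  have hodd' : Odd p := hp.odd_of_ne_two hodd
  -- LTE
  have hval : padicValNat p (x ^ (p ^ a) - 1) = padicValNat p (x - 1) + a := by
    have h1 := padicValNat.pow_sub_pow (p := p) (x := x) (y := 1) hodd' hx1 (by simpa using hfermat)
      (by simpa using hpx) (n := p ^ a) (pow_ne_zero _ hp.ne_zero)
    rw [one_pow, padicValNat.prime_pow] at h1
    exact h1
  -- `p^m ∣ x^{p^a} − 1` gives `m ≤ v_p(x−1) + a`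
  have hxa : x ^ (p ^ a) - 1 ≠ 0 := by
    have : 1 < x ^ (p ^ a) := Nat.one_lt_pow (pow_ne_zero _ hp.ne_zero) hx1
    omega
  have hm : m ≤ padicValNat p (x - 1) + a := by
    rw [← hval]
    have h' : p ^ m ∣ x ^ (p ^ a) - 1 := by rw [hx, ← pow_mul]; exact h
    exact (padicValNat_dvd_iff_le hxa).mp h'
  -- `p^{v_p(x−1)} ∣ x − 1`
  have hdvd : p ^ (padicValNat p (x - 1) + a) ∣ (x - 1) * p ^ a := by
    rw [pow_add]
    exact Nat.mul_dvd_mul pow_padicValNat_dvd (dvd_refl _)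
  exact (pow_dvd_pow p hm).trans hdvd

/-! ## §2 Primes above `ℓ` in `ℚ(ζ_{p^{k+1}})`, `p` odd -/

section Cyclotomic

variable (N : Type) [Field N] [NumberField N] (p k : ℕ) [hp : Fact p.Prime]
  [hN : IsCyclotomicExtension {p ^ (k + 1)} ℚ N]

include hN in
/-- **A prime `ℓ ≠ p` has at most `(ℓ^{p−1} − 1)(p − 1)` primes above it in `ℚ(ζ_{p^{k+1}})`, for every `k`** (`p` odd).  `ℓ` is
unramified with residue degree `f = ord(ℓ mod p^{k+1})` (Mathlib), `g·f = (p−1)·p^k`; with `f = d·p^a`, `p ∤ d`: `d ∣ p − 1`,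
`p^{k+1} ∣ ℓ^f − 1 ∣ ℓ^{(p−1)p^a} − 1`, whence `p^{k+1} ≤ (ℓ^{p−1}−1)·p^a` (§1) and `g·p ≤ (p−1)(ℓ^{p−1}−1)`.
[cite: Washington1997, Thm. 2.13 and §13.1] -/
theorem ncard_primesOver_le_of_isCyclotomicExtension_prime_pow_odd (hodd : p ≠ 2) {ℓ : ℕ} (hℓ : ℓ.Prime) (hℓp : ℓ ≠ p) :
    ((Ideal.span {(ℓ : ℤ)}).primesOver (𝓞 N)).ncard ≤ (ℓ ^ (p - 1) - 1) * (p - 1) := by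
  classical
  have hpp : p.Prime := hp.out
  haveI : Fact ℓ.Prime := ⟨hℓ⟩
  haveI : NeZero (p ^ (k + 1)) := ⟨pow_ne_zero _ hpp.ne_zero⟩
  haveI : IsGalois ℚ N := IsCyclotomicExtension.isGalois {p ^ (k + 1)} ℚ N
  have hpl : ¬ p ∣ ℓ := fun h => hℓp ((Nat.prime_dvd_prime_iff_eq hpp hℓ).mp h).symm
  have hndvd : ¬ ℓ ∣ p ^ (k + 1) := fun h =>
    hℓp ((Nat.prime_dvd_prime_iff_eq hℓ hpp).mp (hℓ.dvd_of_dvd_pow h))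
  -- fundamental identity with `e = 1`, `f = ord(ℓ mod p^{k+1})`
  have hfund := Ideal.ncard_primesOver_mul_ramificationIdxIn_mul_inertiaDegIn (Ideal.span {(ℓ : ℤ)}) (𝓞 N) (N ≃ₐ[ℚ] N)
  rw [IsCyclotomicExtension.Rat.ramificationIdxIn_eq_of_not_dvd ℓ N hndvd,
    IsCyclotomicExtension.Rat.inertiaDegIn_eq_of_not_dvd ℓ N hndvd, one_mul,
    IsGaloisGroup.card_eq_finrank (N ≃ₐ[ℚ] N) ℚ N, IsCyclotomicExtension.Rat.finrank (p ^ (k + 1)) N,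
    Nat.totient_prime_pow_succ hpp] at hfund
  -- `hfund : g * orderOf (ℓ : ZMod p^{k+1}) = p ^ k * (p - 1)`
  set f := orderOf ((ℓ : ℕ) : ZMod (p ^ (k + 1))) with hf
  set g := ((Ideal.span {(ℓ : ℤ)}).primesOver (𝓞 N)).ncard with hg
  have hrhs : p ^ k * (p - 1) ≠ 0 := mul_ne_zero (pow_ne_zero _ hpp.ne_zero) (by have := hpp.two_le; omega)
  have hf0 : f ≠ 0 := fun h0 => by rw [h0, mul_zero] at hfund; exact hrhs hfund.symm
  have hg0 : g ≠ 0 := fun h0 => by rw [h0, zero_mul] at hfund; exact hrhs hfund.symm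
  -- `f = p^a · d` with `p ∤ d`, `d ∣ p − 1`
  set a := f.factorization p with ha
  set d := f / p ^ a with hd
  have hfad : p ^ a * d = f := Nat.ordProj_mul_ordCompl_eq_self f p
  have hcop : Nat.Coprime p d := Nat.coprime_ordCompl hpp hf0
  have hd0 : d ≠ 0 := fun h0 => by rw [h0, mul_zero] at hfad; exact hf0 hfad.symm
  have hddvd : d ∣ p - 1 := by
    have h1 : d ∣ p ^ k * (p - 1) := by
      rw [← hfund, ← hfad]; exact ⟨g * p ^ a, by ring⟩
    exact (Nat.Coprime.pow_left k hcop).symm.dvd_of_dvd_mul_left h1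
  -- `p^{k+1} ∣ ℓ^f − 1 ∣ ℓ^{(p−1)p^a} − 1`
  have hpow : ((ℓ : ℕ) : ZMod (p ^ (k + 1))) ^ f = 1 := pow_orderOf_eq_one _
  have hdvd1 : p ^ (k + 1) ∣ ℓ ^ f - 1 := by
    have h1 : 1 ≤ ℓ ^ f := Nat.one_le_pow _ _ hℓ.pos
    rw [← ZMod.natCast_eq_zero_iff, Nat.cast_sub h1, Nat.cast_pow, Nat.cast_one, hpow, sub_self]
  have hdvd2 : ℓ ^ f - 1 ∣ ℓ ^ ((p - 1) * p ^ a) - 1 := by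
    obtain ⟨c, hc⟩ := hddvd
    have hmul : (p - 1) * p ^ a = f * c := by rw [hc, ← hfad]; ring
    rw [hmul, pow_mul]
    simpa using Nat.sub_dvd_pow_sub_pow (ℓ ^ f) 1 c
  have hdvd := pow_dvd_mul_of_dvd_pow_sub_one_odd hpp hodd hℓ.two_le hpl a (k + 1) (hdvd1.trans hdvd2)
  -- sizes
  have hxpos : 0 < (ℓ ^ (p - 1) - 1) * p ^ a := by
    refine Nat.mul_pos ?_ (pow_pos hpp.pos a)
    have : 2 ^ 1 ≤ ℓ ^ (p - 1) := by
      calc 2 ^ 1 ≤ ℓ ^ 1 := Nat.pow_le_pow_left hℓ.two_le 1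
        _ ≤ ℓ ^ (p - 1) := Nat.pow_le_pow_right hℓ.pos (by have := hpp.two_le; omega)
    omega
  have hle := Nat.le_of_dvd hxpos hdvd
  -- `g·d·p^a = p^k (p−1)` and `p^{k+1} ≤ (ℓ^{p−1}−1) p^a` ⇒ `g·d·p ≤ (p−1)(ℓ^{p−1}−1)`
  have hkey : g * d * p * p ^ a ≤ (ℓ ^ (p - 1) - 1) * (p - 1) * p ^ a := by
    calc g * d * p * p ^ a = (g * f) * p := by rw [← hfad]; ring
      _ = p ^ (k + 1) * (p - 1) := by rw [hfund]; ring
      _ ≤ (ℓ ^ (p - 1) - 1) * p ^ a * (p - 1) := Nat.mul_le_mul_right _ hle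
      _ = (ℓ ^ (p - 1) - 1) * (p - 1) * p ^ a := by ring
  have h2 : g * d * p ≤ (ℓ ^ (p - 1) - 1) * (p - 1) := Nat.le_of_mul_le_mul_right hkey (pow_pos hpp.pos a)
  calc g ≤ g * d * p := by
        calc g = g * 1 * 1 := by ring
          _ ≤ g * d * p := Nat.mul_le_mul (Nat.mul_le_mul_left g (Nat.one_le_iff_ne_zero.mpr hd0)) hpp.one_lt.le
    _ ≤ (ℓ ^ (p - 1) - 1) * (p - 1) := h2

include hN in
/-- **`ℚ(ζ_{p^{k+1}})` has exactly one prime above `p`** (`(ζ − 1)`, totally ramified; Mathlib). [cite: Washington1997, Prop. 2.1] -/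
theorem ncard_primesOver_eq_one_of_isCyclotomicExtension_prime_pow_odd :
    ((Ideal.span {((p : ℕ) : ℤ)}).primesOver (𝓞 N)).ncard = 1 :=
  IsCyclotomicExtension.Rat.ncard_primesOver_of_prime_pow p k N

end Cyclotomic

/-! ## §3 Going down to a subfield: the uniform bound -/

/-- **Uniform bound in every subfield of `ℚ(ζ_{p^{k+1}})`** (`p` odd; e.g. the layer `ℚ_k` of the cyclotomic `ℤ_p`-extension): a
rational prime `ℓ` has at most `(ℓ^{p−1} − 1)(p − 1)` primes above it, for EVERY `k` (for `ℓ = p` there is one, and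
`1 ≤ (p^{p−1} − 1)(p − 1)`). [cite: Washington1997, §13.1] -/
theorem ncard_primesOver_le_of_algebra_isCyclotomicExtension_prime_pow_odd
    (N : Type) [Field N] [NumberField N] (p k : ℕ) [Fact p.Prime] (hodd : p ≠ 2) [IsCyclotomicExtension {p ^ (k + 1)} ℚ N]
    (F : Type) [Field F] [NumberField F] [Algebra F N] {ℓ : ℕ} (hℓ : ℓ.Prime) :
    ((Ideal.span {(ℓ : ℤ)}).primesOver (𝓞 F)).ncard ≤ (ℓ ^ (p - 1) - 1) * (p - 1) := by
  have hpp : p.Prime := Fact.out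
  refine le_trans (ncard_primesOver_le_of_algebra F N hℓ) ?_
  rcases eq_or_ne ℓ p with rfl | hℓp
  · rw [ncard_primesOver_eq_one_of_isCyclotomicExtension_prime_pow_odd N ℓ k]
    have h2 : 2 ≤ ℓ - 1 := by have := hpp.two_le; omega
    have h3 : 1 ≤ ℓ ^ (ℓ - 1) - 1 := by
      have : 2 ^ 1 ≤ ℓ ^ (ℓ - 1) := by
        calc 2 ^ 1 ≤ ℓ ^ 1 := Nat.pow_le_pow_left hpp.two_le 1
          _ ≤ ℓ ^ (ℓ - 1) := Nat.pow_le_pow_right hpp.pos (by omega)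
      omega
    calc 1 = 1 * 1 := by ring
      _ ≤ (ℓ ^ (ℓ - 1) - 1) * (ℓ - 1) := Nat.mul_le_mul h3 (by omega)
  · exact ncard_primesOver_le_of_isCyclotomicExtension_prime_pow_odd N p k hodd hℓ hℓp

end Literature.NumberTheory.NumberFields

end
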